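import Mathlib
import Summits.Ventures.PercRepro2.BHK
import Summits.Ventures.PercRepro2.MergedUnionDefs

/-!
# The pair (cluster, merged cluster) of `t` on induced subgraphs: definitions and the domain
Markov transfer (blind cell PercRepro2, mine-1 g34)

Towards (PAIR-t) — positive association of `(C_t, T*)`, `T* = C_t ∪ (C_X if t ↔ Y)`, given
`s ∉ T*` — by van den Berg–Häggström–Kahn's four-function induction (BHK06 Theorem 1.1) for the
PAIR.  As in the cell's `BHK.lean` the induction runs over induced subgraphs `G[U]`:

* `mergedIn U t Y X ω` — the merged cluster of `t` in `G[U]` (parameters cut down to `U`);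
* `RmEvent U t Y X Za` — the avoidance event `{T*^U ∩ Za = ∅}`;
* `pairObs U t Y X Φ` — a functional of the pair `(C^U_t, T*^U)`;
* `ghostFrontier U Z X Y ω` — the frontier of `Z` in `U`, plus `(Y ∩ U) ∖ Z` when `Z` meets `X`:
  in the ghost graph `G + (X → z → Y)` the ghost vertex is entered from `Z` exactly when `Z ∩ X ≠ ∅`,
  and it enters `Y`; avoiding the ghost is avoiding `Y`.

The transfer theorem `pairObs_mul_indicator_eq`: for `t ∉ Z ⊆ U`,
`Φ(C^U_t, T*^U) 1_{R^U_{W∪Z}} = Φ(C^{U∖Z}_t, T*^{U∖Z}[Y∖Z, X∖Z]) 1_{R^{U∖Z}_{W ∪ ghostFrontier}}`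
configuration by configuration — the merged analogue of `clusterObs_mul_indicator_eq`.
-/

namespace Summit.Ventures.PercRepro2

namespace MergedU

section PairDefs

variable {V : Type*} {E : Type*} [Fintype E] [DecidableEq V] {R : Type*}

/-- The merged cluster of `t` in `G[U]`, with the parameters `Y, X` cut down to `U`. -/
def mergedIn (ends : E → Sym2 V) (U : Finset V) (t : V) (Y X : Finset V) (ω : Config E) :
    Set V :=
  merged ends (induced ends (↑U) ω) t (↑(Y ∩ U)) (↑(X ∩ U))

/-- The avoidance event `{T*^U ∩ Za = ∅}`. -/
def RmEvent (ends : E → Sym2 V) (U : Finset V) (t : V) (Y X Za : Finset V) : Set (Config E) :=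
  {ω | ∀ a ∈ Za, a ∉ mergedIn ends U t Y X ω}

/-- A functional of the pair `(C^U_t, T*^U)`. -/
def pairObs (ends : E → Sym2 V) (U : Finset V) (t : V) (Y X : Finset V)
    (Φ : Set V → Set V → R) : Config E → R :=
  fun ω => Φ (clusterIn ends U t ω) (mergedIn ends U t Y X ω)

/-- The ghost frontier of `Z` in `U`: the frontier, plus `(Y ∩ U) ∖ Z` when `Z` meets `X`. -/
def ghostFrontier (ends : E → Sym2 V) (U Z X Y : Finset V) (ω : Config E) : Finset V :=
  frontier ends U Z ω ∪ (if (X ∩ Z).Nonempty then (Y ∩ U) \ Z else ∅)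

variable {ends : E → Sym2 V} {U : Finset V} {t : V} {Y X : Finset V}

omit [Fintype E] in
/-- Membership in `mergedIn`. -/
lemma mem_mergedIn {ω : Config E} {v : V} :
    v ∈ mergedIn ends U t Y X ω ↔ Conn ends (induced ends (↑U) ω) t v ∨
      ((∃ y ∈ Y ∩ U, Conn ends (induced ends (↑U) ω) t y) ∧
        ∃ x ∈ X ∩ U, Conn ends (induced ends (↑U) ω) x v) := by
  simp only [mergedIn, mem_merged, Finset.mem_coe]

omit [Fintype E] in
/-- `C^U_t ⊆ T*^U`. -/
lemma clusterIn_subset_mergedIn (ω : Config E) : clusterIn ends U t ω ⊆ mergedIn ends U t Y X ω :=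
  fun _ hv => Or.inl hv

omit [Fintype E] in
/-- `t ∈ T*^U`. -/
lemma mem_mergedIn_self (ω : Config E) : t ∈ mergedIn ends U t Y X ω :=
  clusterIn_subset_mergedIn ω (mem_cluster_self _ _ _)

omit [Fintype E] in
/-- `mergedIn` is monotone in the configuration. -/
lemma mergedIn_mono {ω ω' : Config E} (h : ω ≤ ω') :
    mergedIn ends U t Y X ω ⊆ mergedIn ends U t Y X ω' :=
  merged_mono (induced_mono h) t _ _

omit [Fintype E] in
/-- `RmEvent` is decreasing. -/
lemma isLowerSet_RmEvent (Za : Finset V) : IsLowerSet (RmEvent ends U t Y X Za) :=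
  fun _ _ h hω a ha hmem => hω a ha (mergedIn_mono h hmem)

omit [Fintype E] in
/-- Membership in `RmEvent`. -/
@[simp] lemma mem_RmEvent {Za : Finset V} {ω : Config E} :
    ω ∈ RmEvent ends U t Y X Za ↔ ∀ a ∈ Za, a ∉ mergedIn ends U t Y X ω := Iff.rfl

omit [Fintype E] in
/-- `R_{A ∪ B} = R_A ∩ R_B`. -/
lemma RmEvent_union (A B : Finset V) :
    RmEvent ends U t Y X (A ∪ B) = RmEvent ends U t Y X A ∩ RmEvent ends U t Y X B := by
  ext ω
  simp only [mem_RmEvent, Finset.forall_mem_union, Set.mem_inter_iff]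

omit [Fintype E] in
/-- `R_∅` is the sure event. -/
lemma RmEvent_empty : RmEvent ends U t Y X ∅ = Set.univ := by
  ext ω
  simp [mem_RmEvent]

omit [Fintype E] in
/-- `R` is antitone in the avoided set. -/
lemma RmEvent_anti {A A' : Finset V} (h : A ⊆ A') :
    RmEvent ends U t Y X A' ⊆ RmEvent ends U t Y X A :=
  fun _ hω a ha => hω a (h ha)

omit [Fintype E] in
/-- If `t ∈ Za` the avoidance event is empty. -/
lemma RmEvent_eq_empty_of_mem {Za : Finset V} (ht : t ∈ Za) :
    RmEvent ends U t Y X Za = ∅ := by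
  ext ω
  simp only [mem_RmEvent, Set.mem_empty_iff_false, iff_false, not_forall, not_not]
  exact ⟨t, ht, mem_mergedIn_self ω⟩

omit [Fintype E] in
/-- `mergedIn` only sees the edges inside `U`. -/
lemma dependsOn_mergedIn : DependsOn (mergedIn ends U t Y X) (within ends (↑U)) := by
  intro ω ω' h
  simp only [mergedIn]
  rw [induced_congr h]

omit [Fintype E] [DecidableEq V] in
/-- `clusterIn` only sees the edges inside `U`. -/
lemma dependsOn_clusterIn : DependsOn (clusterIn ends U t) (within ends (↑U)) := by
  intro ω ω' h
  simp only [clusterIn]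
  rw [induced_congr h]

omit [Fintype E] in
/-- `pairObs` only sees the edges inside `U`. -/
lemma dependsOn_pairObs (Φ : Set V → Set V → R) :
    DependsOn (pairObs ends U t Y X Φ) (within ends (↑U)) := by
  intro ω ω' h
  simp only [pairObs]
  rw [dependsOn_clusterIn h, dependsOn_mergedIn h]

omit [Fintype E] in
/-- `RmEvent` only sees the edges inside `U`. -/
lemma dependsOn_RmEvent (Za : Finset V) :
    DependsOn (· ∈ RmEvent ends U t Y X Za) (within ends (↑U)) := by
  intro ω ω' h
  simp only [mem_RmEvent]
  rw [dependsOn_mergedIn h]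

omit [Fintype E] in
/-- `pairObs` is monotone in the configuration for `Φ` monotone in both arguments. -/
lemma monotone_pairObs [Preorder R] {Φ : Set V → Set V → R}
    (hΦ : ∀ ⦃C C' D D' : Set V⦄, C ⊆ C' → D ⊆ D' → Φ C D ≤ Φ C' D') :
    Monotone (pairObs ends U t Y X Φ) :=
  fun _ _ h => hΦ (clusterIn_mono h) (mergedIn_mono h)

/-- The ghost frontier lies in `U ∖ Z`. -/
lemma ghostFrontier_subset {Z : Finset V} (ω : Config E) :
    ghostFrontier ends U Z X Y ω ⊆ U \ Z := by
  unfold ghostFrontier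
  refine Finset.union_subset (frontier_subset ω) ?_
  split_ifs
  · intro a ha
    rw [Finset.mem_sdiff] at ha ⊢
    exact ⟨(Finset.mem_inter.1 ha.1).2, ha.2⟩
  · exact Finset.empty_subset _

/-- The ghost frontier is `∪`-additive. -/
lemma ghostFrontier_sup {Z : Finset V} (ω ω' : Config E) :
    ghostFrontier ends U Z X Y (ω ⊔ ω') =
      ghostFrontier ends U Z X Y ω ∪ ghostFrontier ends U Z X Y ω' := by
  unfold ghostFrontier
  rw [frontier_sup]
  ext a
  simp only [Finset.mem_union]
  tauto

/-- The ghost frontier is `∩`-subadditive. -/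
lemma ghostFrontier_inf_subset {Z : Finset V} (ω ω' : Config E) :
    ghostFrontier ends U Z X Y (ω ⊓ ω') ⊆
      ghostFrontier ends U Z X Y ω ∩ ghostFrontier ends U Z X Y ω' := by
  unfold ghostFrontier
  intro a ha
  rw [Finset.mem_inter]
  simp only [Finset.mem_union] at ha ⊢
  rcases ha with ha | ha
  · have := Finset.mem_inter.1 (frontier_inf_subset ω ω' ha)
    exact ⟨Or.inl this.1, Or.inl this.2⟩
  · exact ⟨Or.inr ha, Or.inr ha⟩

/-- The ghost frontier is determined by the edges touching `Z`. -/
lemma dependsOn_ghostFrontier (Z : Finset V) :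
    DependsOn (ghostFrontier ends U Z X Y) (touches ends (↑Z)) := by
  intro ω ω' h
  unfold ghostFrontier
  rw [dependsOn_frontier ends U Z h]

end PairDefs

/-! ## The domain Markov transfer for the pair -/

section PairTransfer

variable {V : Type*} {E : Type*} [Fintype E] [DecidableEq V] {ends : E → Sym2 V}
  {U Z : Finset V} {t : V} {Y X : Finset V}

omit [Fintype E] in
/-- Connections in `G[U ∖ Z]` are connections in `G[U]`. -/
lemma conn_induced_of_conn_sdiff {ω : Config E} {u v : V}
    (h : Conn ends (induced ends (↑(U \ Z)) ω) u v) : Conn ends (induced ends (↑U) ω) u v :=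
  conn_mono (induced_mono_set (Finset.coe_subset.2 Finset.sdiff_subset) ω) h

omit [Fintype E] in
/-- On `{T*^U ∩ Z = ∅}` the cluster of `t` avoids `Z` in `G[U]`. -/
lemma not_conn_of_RmEvent {ω : Config E} (hRm : ∀ z ∈ Z, z ∉ mergedIn ends U t Y X ω) :
    ∀ z ∈ Z, ¬ Conn ends (induced ends (↑U) ω) t z :=
  fun z hz hc => hRm z hz (Or.inl hc)

omit [Fintype E] in
/-- On `{T*^U ∩ Z = ∅}` with `Z ∩ X ≠ ∅`, `t` is not connected to `Y` in `G[U]`. -/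
lemma not_conn_Y_of_RmEvent {ω : Config E} (hRm : ∀ z ∈ Z, z ∉ mergedIn ends U t Y X ω)
    (hXZ : (X ∩ Z).Nonempty) (hZU : Z ⊆ U) :
    ¬ ∃ y ∈ Y ∩ U, Conn ends (induced ends (↑U) ω) t y := by
  rintro hY
  obtain ⟨x, hx⟩ := hXZ
  rw [Finset.mem_inter] at hx
  exact hRm x hx.2 (Or.inr ⟨hY, x, Finset.mem_inter.2 ⟨hx.1, hZU hx.2⟩, conn_refl _ _ _⟩)

omit [Fintype E] in
/-- On `{T*^U ∩ Z = ∅}` with `t ↔ Y`, the cluster of every `x ∈ X ∩ U` avoids `Z` in `G[U]`. -/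
lemma not_conn_x_of_RmEvent {ω : Config E} (hRm : ∀ z ∈ Z, z ∉ mergedIn ends U t Y X ω)
    (hY : ∃ y ∈ Y ∩ U, Conn ends (induced ends (↑U) ω) t y) {x : V} (hx : x ∈ X ∩ U) :
    ∀ z ∈ Z, ¬ Conn ends (induced ends (↑U) ω) x z :=
  fun z hz hc => hRm z hz (Or.inr ⟨hY, x, hx, hc⟩)

omit [Fintype E] in
/-- **Transfer of the merged cluster**: on `{T*^U ∩ Z = ∅}`, with `t ∉ Z ⊆ U`,
`T*^{U∖Z}[Y∖Z, X∖Z] = T*^U[Y, X]`. -/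
theorem mergedIn_sdiff_eq {ω : Config E} (hRm : ∀ z ∈ Z, z ∉ mergedIn ends U t Y X ω) :
    mergedIn ends (U \ Z) t (Y \ Z) (X \ Z) ω = mergedIn ends U t Y X ω := by
  have hRt := not_conn_of_RmEvent hRm
  have hct : ∀ v, Conn ends (induced ends (↑(U \ Z)) ω) t v ↔
      Conn ends (induced ends (↑U) ω) t v :=
    fun v => ⟨conn_induced_of_conn_sdiff, conn_induced_sdiff_of_conn hRt⟩
  -- `t ↔ Y` transfers (the cluster of `t` avoids `Z`)
  have hYiff : (∃ y ∈ (Y \ Z) ∩ (U \ Z), Conn ends (induced ends (↑(U \ Z)) ω) t y) ↔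
      ∃ y ∈ Y ∩ U, Conn ends (induced ends (↑U) ω) t y := by
    constructor
    · rintro ⟨y, hy, hc⟩
      rw [Finset.mem_inter, Finset.mem_sdiff, Finset.mem_sdiff] at hy
      exact ⟨y, Finset.mem_inter.2 ⟨hy.1.1, hy.2.1⟩, (hct y).1 hc⟩
    · rintro ⟨y, hy, hc⟩
      have hyZ : y ∉ Z := fun hyZ => hRt y hyZ hc
      rw [Finset.mem_inter] at hy
      exact ⟨y, Finset.mem_inter.2 ⟨Finset.mem_sdiff.2 ⟨hy.1, hyZ⟩, Finset.mem_sdiff.2 ⟨hy.2, hyZ⟩⟩,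
        (hct y).2 hc⟩
  ext v
  simp only [mem_mergedIn]
  rw [hct v, hYiff]
  refine or_congr Iff.rfl ?_
  constructor
  · rintro ⟨hY, x, hx, hc⟩
    rw [Finset.mem_inter, Finset.mem_sdiff, Finset.mem_sdiff] at hx
    exact ⟨hY, x, Finset.mem_inter.2 ⟨hx.1.1, hx.2.1⟩, conn_induced_of_conn_sdiff hc⟩
  · rintro ⟨hY, x, hx, hc⟩
    have hRx := not_conn_x_of_RmEvent hRm hY hx
    have hxZ : x ∉ Z := fun hxZ => hRx x hxZ (conn_refl _ _ _)
    rw [Finset.mem_inter] at hx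
    exact ⟨hY, x, Finset.mem_inter.2 ⟨Finset.mem_sdiff.2 ⟨hx.1, hxZ⟩, Finset.mem_sdiff.2 ⟨hx.2, hxZ⟩⟩,
      conn_induced_sdiff_of_conn hRx hc⟩

/-- **Transfer of the avoidance event**: for `t ∉ Z ⊆ U`,
`R^U_{W ∪ Z}[Y, X] = {ω | ω ∈ R^{U∖Z}_{W ∪ ghostFrontier ω}[Y∖Z, X∖Z]}`. -/
theorem RmEvent_union_eq (hZU : Z ⊆ U) (htZ : t ∉ Z) (W : Finset V) :
    RmEvent ends U t Y X (W ∪ Z) =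
      {ω | ω ∈ RmEvent ends (U \ Z) t (Y \ Z) (X \ Z) (W ∪ ghostFrontier ends U Z X Y ω)} := by
  ext ω
  simp only [Set.mem_setOf_eq, mem_RmEvent, Finset.forall_mem_union]
  constructor
  · rintro ⟨hW, hZ⟩
    have htr := mergedIn_sdiff_eq hZ
    rw [htr]
    refine ⟨hW, ?_⟩
    intro a ha
    unfold ghostFrontier at ha
    rw [Finset.mem_union] at ha
    rcases ha with ha | ha
    · -- a frontier vertex in `T*^U` would put its `Z`-neighbour in `T*^U`
      obtain ⟨⟨haU, haZ⟩, e, he, z, hz, hends⟩ := mem_frontier.1 ha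
      intro hmem
      rw [mem_mergedIn] at hmem
      have hadj : Conn ends (induced ends (↑U) ω) a z :=
        conn_of_openAdj ⟨e, induced_eq_true_iff.2 ⟨he, a, Finset.mem_coe.2 haU, z,
          Finset.mem_coe.2 (hZU hz), hends⟩, hends⟩
      apply hZ z hz
      rw [mem_mergedIn]
      rcases hmem with hmem | ⟨hY, x, hx, hc⟩
      · exact Or.inl (conn_trans hmem hadj)
      · exact Or.inr ⟨hY, x, hx, conn_trans hc hadj⟩
    · split_ifs at ha with hXZ
      · -- `Z` meets `X`: `t ↮ Y`, so `T*^U = C^U_t`, which avoids `Y`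
        rw [Finset.mem_sdiff, Finset.mem_inter] at ha
        intro hmem
        rw [mem_mergedIn] at hmem
        have hnY := not_conn_Y_of_RmEvent hZ hXZ hZU
        rcases hmem with hmem | ⟨hY, _⟩
        · exact hnY ⟨a, Finset.mem_inter.2 ⟨ha.1.1, ha.1.2⟩, hmem⟩
        · exact hnY hY
      · exact absurd ha (Finset.notMem_empty a)
  · rintro ⟨hW, hS⟩
    -- first: `T*^U` avoids `Z`
    have hFr : ∀ a ∈ frontier ends U Z ω, a ∉ mergedIn ends (U \ Z) t (Y \ Z) (X \ Z) ω :=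
      fun a ha => hS a (Finset.mem_union_left _ ha)
    have hRt : ∀ z ∈ Z, ¬ Conn ends (induced ends (↑U) ω) t z :=
      not_conn_of_not_conn_frontier htZ fun a ha hc => hFr a ha (Or.inl hc)
    have hZ : ∀ z ∈ Z, z ∉ mergedIn ends U t Y X ω := by
      intro z hz hmem
      rw [mem_mergedIn] at hmem
      rcases hmem with hmem | ⟨hY, x, hx, hc⟩
      · exact hRt z hz hmem
      · -- `t ↔ Y` in `G[U]`
        obtain ⟨y, hy, hty⟩ := hY
        have hyZ : y ∉ Z := fun hyZ => hRt y hyZ hty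
        rw [Finset.mem_inter] at hy
        have hty' : Conn ends (induced ends (↑(U \ Z)) ω) t y := conn_induced_sdiff_of_conn hRt hty
        have hY' : ∃ y ∈ (Y \ Z) ∩ (U \ Z), Conn ends (induced ends (↑(U \ Z)) ω) t y :=
          ⟨y, Finset.mem_inter.2 ⟨Finset.mem_sdiff.2 ⟨hy.1, hyZ⟩, Finset.mem_sdiff.2 ⟨hy.2, hyZ⟩⟩,
            hty'⟩
        by_cases hXZ : (X ∩ Z).Nonempty
        · -- the ghost frontier contains `(Y ∩ U) ∖ Z ∋ y`, but `y ∈ C^{U∖Z}_t`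
          have hyS : y ∈ ghostFrontier ends U Z X Y ω := by
            unfold ghostFrontier
            rw [Finset.mem_union, if_pos hXZ]
            exact Or.inr (Finset.mem_sdiff.2 ⟨Finset.mem_inter.2 ⟨hy.1, hy.2⟩, hyZ⟩)
          exact hS y hyS (Or.inl hty')
        · -- `x ∉ Z`; the cluster of `x` in `G[U ∖ Z]` avoids the frontier, hence avoids `Z`
          rw [Finset.not_nonempty_iff_eq_empty] at hXZ
          rw [Finset.mem_inter] at hx
          have hxZ : x ∉ Z := fun hxZ => by
            have : x ∈ X ∩ Z := Finset.mem_inter.2 ⟨hx.1, hxZ⟩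
            rw [hXZ] at this
            exact Finset.notMem_empty x this
          have hx' : x ∈ (X \ Z) ∩ (U \ Z) :=
            Finset.mem_inter.2 ⟨Finset.mem_sdiff.2 ⟨hx.1, hxZ⟩, Finset.mem_sdiff.2 ⟨hx.2, hxZ⟩⟩
          have hRx : ∀ z ∈ Z, ¬ Conn ends (induced ends (↑U) ω) x z :=
            not_conn_of_not_conn_frontier hxZ fun a ha hc => hFr a ha (Or.inr ⟨hY', x, hx', hc⟩)
          exact hRx z hz hc
    have htr := mergedIn_sdiff_eq hZ
    rw [htr] at hW
    exact ⟨hW, hZ⟩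

end PairTransfer

end MergedU

end Summit.Ventures.PercRepro2
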